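import Summits.ResolutionOfSingularities.ResolutionOfSingularities.Theorems.HilbertSamuelEliminationSigmaMaxModificationsCorridor3SigmaStrataRows
import Summits.ResolutionOfSingularities.ResolutionOfSingularities.Theorems.HilbertSamuelEliminationSigmaMaxModificationsCorridor3WLadderLocalChainsLocalize
import Summits.ResolutionOfSingularities.ResolutionOfSingularities.Theorems.HilbertSamuelEliminationSigmaMaxModificationsCorridor3WLadderLocalChainsTerminate
import HarnessLib

/-!
# [OURS · L1 W4.2] σ-LAYER — Ω-TRANSPORT brick 4: the H-LAYER over Ω⁺ — the transfer row (T) along Ω⁺-chains and ROW (c-geo)σ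
# `StrataLineageInCentreIOσ (Strategy.ofStageOraclePlus ω) p N (QNe Q) G` DISCHARGED (modulo the printed kill row) for `0 < N ≤ 3`

Crux chain w42 (`SigmaMaxModifications`, stmt-ResolutionOfSingularities-18506; conjunct `SigmaMaxModificationsCorridor3`,
stmt-ResolutionOfSingularities-19249), res-L1-w42-plan-1 RULING v3.14-12 (BR-6) / v3.14-14 (DL) «Ω-transports of the W-low rows — 040»,
object (i) of res-type-040's 11:45:33Z line («σ-transport of the PROVED (c-geo) discharge over `CycleInvPlus`»). Typer res-type-040 (gen 19).
OURS (cell res-hironaka, slot W4.2); NOT statements of H. Hironaka's manuscript [Hironaka2017] nor of [CossartJannsenSaito2020]; AI-drafted,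
weaker than expert review. Sorry-free PROOF file: no new definition, no named fact, no binder. Helper file
`--supports stmt-ResolutionOfSingularities-19249` (counted 0).

WHAT IS TRANSPORTED. res-type-053's THEOREM `Moving.movingLineageLocalizesM_holds` (transfer row (T), `…WLadderLocalChainsLocalize`, p513904's
H-layer) and res-type-040's composition `Moving.strataLineageInCentreIO_of_localChains` ((T) ∧ (K) ⇒ (c-geo), `…WLadderLocalChains`) from the
CJS strategies `Strategy.cjs R` to the Ω⁺ strategies `Strategy.ofStageOraclePlus ω` of a FUNCTIONAL, Ω⁺-ADMISSIBLE stage oracle `ω`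
(res-type-040 gen 18, `…Corridor3SigmaCyclePlusDefs` p523517), along chains under the Ω⁺ cycle invariant `CycleInvPlus` (`…SigmaCyclePlusScope`,
p524819). The kill row (K) `Moving.LocalNearPointChainsTerminate` is strategy-free and enters unchanged (res-D-pv-046's
`localNearPointChainsTerminate_of_printedFacts` over the printed bundle `LocalChainPrintedFacts`).

HOW. §1 STRATEGY-FREE chain lemmas over BLOW-UP DATA `f n : X_{n+1} ⟶ X_n`, `C n` with `IsBlowup (f n) (C n)` (no oracle, no strategy):
generic point over generic point, heights of the generic points non-decreasing and bounded by the dimension bound hence eventually constant,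
and then «`η_{n+1}` is the only point over `η_n` it specializes to» (res-type-053's chain-lifting argument, file A §1/§4, re-keyed from
`Helpers.chainProj`/`chainCentre` to arbitrary blow-up data); a MISS is a stalk isomorphism; stalk isomorphisms compose along misses.
§2 `CycleInvPlus.cycleInv_forget`: the oracle-free structural part of stub-4's `Moving.CycleInv` (finite type over `k`, reduced, `dim ≤ N`,
`ν` never exceeded, labels `≤` year) holds at an Ω⁺ stage under `CycleInvPlus` once its cycle state is FORGOTTEN (`P := none`; the two
invariants differ only in their pending clause), so file A §3 (`hsFun_le_hsFun_of_specializes`, `eq_of_specializes_of_mem_hsStratum`,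
`isIsolatedInHSMaxLocus_closedPoint_of_isGenericPoint`, `isExcellent_Spec_stalk`) and stub-4's `singleton_notMem_componentsIn_of_not_iso`
transfer by name. §3 the transfer row along Ω⁺-chains (`Sigma.movingLineageLocalizes_Ωplus`, any level `N`, conclusion `dim S_0 ≤ N − 1`):
053's construction verbatim with THE chain's projections/centres replaced by the lineage's own step projections (`choose`) and the centres they
present, hits identified by `IsCanonicalStepΩplus.centre_unique` (functional `ω`), centres regular and inside `X_n(ν)` by `CycleInvPlus.centre`
(this is where `ν ≠ Φ^{(N)}` and Ω⁺-admissibility enter). §4 ROW (c-geo)σ over Ω⁺ at `QNe Q` for `0 < N ≤ 3` (the kill row needs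
`dim S_0 ≤ 2` and `dim S_0 < N`), at `N = 3` by name, modulo print (`LocalChainPrintedFacts`), and the feeds BY NAME into brick 3b
(`…SigmaStrataRows`, p529370): row (c)σ and the strata-half `MaxOriginNoMovingNearChainAtQσ … (QNe Q) (G ∧ ¬ Iso)` over Ω⁺ from
(b-end)σ⁺ ∧ (c-rep)σ⁺ ∧ (K) alone.

WHY `QNe Q` (and not `Q`): at the regular value `ν = Φ^{(N)}` an Ω⁺-admissible stage oracle may blow up non-empty regular centres of the
regular first stage (the relaxation «centres over `(regular locus)ᶜ`» → «permissible for `S`» of `OracleAdmissibleΩplus`), so the CJS lemma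
`IsMaximalOrigin.not_isBlownUp_of_eq_iterPSum` has no Ω⁺ twin; the regular value is row (D)σ's business (`maxOriginNoMovingNearChainAtQσ_of_qNe`).

References: CJS LNM 2270 Lemma 6.30 (proof via `X_η`, p. 97), Prop. 6.31, Rem. 6.29 (1), Def. 6.38/6.39, p. 98 Step 9, p. 107
[CossartJannsenSaito2020]; Stacks Tags 00GU, 02OS, 02IZ [StacksProject]; tree `…WLadderLineageGenericPoints` / `…WLadderLocalChainsLocalize`
(p513904, res-type-053), `…WLadderLocalChainsDefs` (p512269), `…WLadderLocalChainsTerminate` (res-D-pv-046), `…SigmaCyclePlusScope` (p524819),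
`…SigmaStrataParts` (p528621), `…SigmaStrataRows` (p529370); card H `L/res-L1-w42-idea-2/idea-generic-point-descent.md`.
-/

noncomputable section

set_option linter.dupNamespace false

open CategoryTheory CategoryTheory.Limits AlgebraicGeometry TopologicalSpace Topology IsLocalRing Order
open Summit.ResolutionOfSingularities.ResolutionOfSingularities.Theorems.CampaignW42
open Literature.AlgebraicGeometry.Resolution Literature.RingTheory.HilbertSamuel
open Literature.AlgebraicGeometry.CossartJannsenSaito2020
open Summit.ResolutionOfSingularities.ResolutionOfSingularities.Theorems.SigmaMaxModificationsCorridor3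
open Summit.ResolutionOfSingularities.ResolutionOfSingularities.Theorems.SigmaMaxModificationsCorridor3.Moving
open Scheme.IdealSheafData

namespace Summit.ResolutionOfSingularities.ResolutionOfSingularities.Theorems.SigmaMaxModificationsCorridor3.Sigma

universe u

/-! ## §1. Strategy-free chain lemmas over blow-up data -/

section BlowupData

variable {N : ℕ} {ν : ℕ → ℕ} {c : ℕ → MarkedStage.{u}} {f : ∀ n, (c (n + 1)).W ⟶ (c n).W}
  {C : ∀ n, (c n).W.IdealSheafData}

/-- A blow-down map of a locally noetherian stage is universally closed. [cite: GortzWedhorn2020, Prop. 13.96 (1)] -/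
theorem universallyClosed_of_isBlowup_stage (hb : ∀ n, IsBlowup (f n) (C n)) (n : ℕ) : UniversallyClosed (f n) := by
  haveI := (c n).ln
  haveI : IsProper (f n) := (hb n).isProper
  infer_instance

/-- **Generic point over generic point** along a dominating lineage (`closure (f_n '' Z_{n+1}) = Z_n`). [cite: StacksProject, Tag 0061] -/
theorem base_genericPoint_of_dom {Z : ∀ n, Set (c n).W} {η : ∀ n, (c n).W} (hη : ∀ n, IsGenericPoint (η n) (Z n))
    (hdom : ∀ n, closure ((f n).base '' Z (n + 1)) = Z n) (n : ℕ) : (f n).base (η (n + 1)) = η n :=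
  base_eq_of_isGenericPoint_of_closure_image_eq _ (hdom n) (hη (n + 1)) (hη n)

/-- The heights of the generic points of a dominating lineage are non-decreasing along blow-downs. [cite: StacksProject, Tag 00GU] -/
theorem height_genericPoint_mono_of_isBlowup (hb : ∀ n, IsBlowup (f n) (C n)) {Z : ∀ n, Set (c n).W} {η : ∀ n, (c n).W}
    (hη : ∀ n, IsGenericPoint (η n) (Z n)) (hdom : ∀ n, closure ((f n).base '' Z (n + 1)) = Z n) (n : ℕ) :
    height (η n) ≤ height (η (n + 1)) := by
  haveI := universallyClosed_of_isBlowup_stage hb n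
  rw [← base_genericPoint_of_dom hη hdom n]
  exact height_base_le_height _ _

/-- Heights are bounded by a dimension bound of the stages. [cite: StacksProject, Tag 02IZ] -/
theorem height_le_of_dim_le (hdim : ∀ n, topologicalKrullDim (c n).W ≤ (N : WithBot ℕ∞)) (η : ∀ n, (c n).W) (n : ℕ) :
    height (η n) ≤ (N : ℕ∞) := by
  have h1 := Literature.AlgebraicGeometry.Dimension.height_add_coheight_le_topologicalKrullDim (η n)
  have h2 : ((height (η n) + coheight (η n) : ℕ∞) : WithBot ℕ∞) ≤ (N : WithBot ℕ∞) := h1.trans (hdim n)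
  have h3 : height (η n) + coheight (η n) ≤ (N : ℕ∞) := by exact_mod_cast h2
  exact le_trans le_self_add h3

/-- **EVENTUALLY `η_{n+1}` IS THE ONLY POINT OVER `η_n` WHICH IT SPECIALIZES TO** («the generic point of the lineage is closed in its
fibre»), for a dominating lineage along blow-downs of stages of dimension `≤ N`: the heights are non-decreasing and bounded, hence
eventually constant, and a second such point would raise the height (res-type-053's chain-lifting argument, strategy-free form).
[cite: CossartJannsenSaito2020, Lemma 6.30] -/
theorem exists_forall_eq_genericPoint_of_specializes_of_isBlowup (hb : ∀ n, IsBlowup (f n) (C n))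
    (hdim : ∀ n, topologicalKrullDim (c n).W ≤ (N : WithBot ℕ∞)) {Z : ∀ n, Set (c n).W} {η : ∀ n, (c n).W}
    (hη : ∀ n, IsGenericPoint (η n) (Z n)) (hdom : ∀ n, closure ((f n).base '' Z (n + 1)) = Z n) :
    ∃ n₀, ∀ n, n₀ ≤ n → ∀ y : (c (n + 1)).W, η (n + 1) ⤳ y → (f n).base y = η n → y = η (n + 1) := by
  have hfin : ∀ n, height (η n) ≠ ⊤ := fun n => ne_top_of_le_ne_top (ENat.coe_ne_top N) (height_le_of_dim_le hdim η n)
  let d : ℕ → ℕ := fun n => (height (η n)).toNat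
  have hd : ∀ n, (d n : ℕ∞) = height (η n) := fun n => ENat.coe_toNat (hfin n)
  have hmono : Monotone d := by
    refine monotone_nat_of_le_succ fun n => ?_
    have := height_genericPoint_mono_of_isBlowup hb hη hdom n
    rw [← hd n, ← hd (n + 1)] at this
    exact_mod_cast this
  have hbdd : ∀ n, d n ≤ N := fun n => by
    have := height_le_of_dim_le hdim η n
    rw [← hd n] at this
    exact_mod_cast this
  obtain ⟨j, n₀, hj⟩ := Cruxes.SigmaMaxModifications.MovingCompactnessLine.eventually_const_of_monotone_of_bounded hmono hbdd
  refine ⟨n₀, fun n hn y hy hfy => ?_⟩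
  by_contra hne
  haveI := universallyClosed_of_isBlowup_stage hb n
  have hstrict := height_base_add_one_le_height (f n) hy (Ne.symm hne)
    (hfy.trans (base_genericPoint_of_dom hη hdom n).symm)
  rw [base_genericPoint_of_dom hη hdom n, ← hd n, ← hd (n + 1), hj n hn, hj (n + 1) (Nat.le_succ_of_le hn)] at hstrict
  have : (j : ℕ∞) + 1 ≤ (j : ℕ∞) := hstrict
  exact absurd this (by exact_mod_cast Nat.not_succ_le_self j)

/-- **A MISS IS A LOCAL ISOMORPHISM**: if `f_n y ∉ supp C_n` then the stalk map of `f_n` at `y` is an isomorphism (a blow-up is an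
isomorphism off its centre). [cite: StacksProject, Tag 02OS] -/
theorem isIso_stalkMap_of_notMem_of_isBlowup (hb : ∀ n, IsBlowup (f n) (C n)) {n : ℕ} {y : (c (n + 1)).W}
    (hy : (f n).base y ∉ ((C n).support : Set (c n).W)) : IsIso ((f n).stalkMap y) := by
  haveI := (c n).ln
  haveI := (hb n).isIso_compl
  exact isIso_stalkMap_of_isIso_morphismRestrict (f n) ⟨((C n).support : Set (c n).W)ᶜ, (C n).support.isClosed.isOpen_compl⟩ y hy

/-- **Along consecutive MISSES the local rings at the generic points do not change**: if no `η (a + i)`, `i < j`, lies in `supp C_{a+i}`,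
then `𝒪_{X_a, η_a} ≅ 𝒪_{X_{a+j}, η_{a+j}}`. [cite: StacksProject, Tag 02OS] -/
theorem nonempty_stalkIso_of_misses_of_isBlowup (hb : ∀ n, IsBlowup (f n) (C n)) {η : ∀ n, (c n).W}
    (hover : ∀ n, (f n).base (η (n + 1)) = η n) (a : ℕ) :
    ∀ j : ℕ, (∀ i, i < j → η (a + i) ∉ ((C (a + i)).support : Set (c (a + i)).W)) →
      Nonempty ((c a).W.presheaf.stalk (η a) ≅ (c (a + j)).W.presheaf.stalk (η (a + j)))
  | 0, _ => ⟨Iso.refl _⟩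
  | j + 1, hmiss => by
    obtain ⟨e⟩ := nonempty_stalkIso_of_misses_of_isBlowup hb hover a j fun i hi => hmiss i (Nat.lt_succ_of_lt hi)
    have hnot : (f (a + j)).base (η (a + j + 1)) ∉ ((C (a + j)).support : Set (c (a + j)).W) := by
      rw [hover]
      exact hmiss j (Nat.lt_succ_self j)
    haveI := isIso_stalkMap_of_notMem_of_isBlowup hb hnot
    let e₁ : (c (a + j)).W.presheaf.stalk (η (a + j)) ≅ (c (a + j)).W.presheaf.stalk ((f (a + j)).base (η (a + j + 1))) :=
      eqToIso (by rw [hover])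
    exact ⟨e ≪≫ e₁ ≪≫ asIso ((f (a + j)).stalkMap (η (a + j + 1)))⟩

end BlowupData

/-! ## §2. The oracle-free structural part of the cycle invariant at an Ω⁺ stage -/

section Stage

variable {N : ℕ} {ν : ℕ → ℕ} {k : Type u} [Field k] {s : MarkedStage.{u}}

/-- **FORGETTING THE CYCLE STATE, an Ω⁺ stage under `CycleInvPlus` satisfies stub-4's `CycleInv`** (for any oracle parameter `R`, which
`CycleInv`'s fields never mention): the two invariants share the clauses finite type over `k` · reduced · `dim ≤ N` · `ν` never exceeded ·
labels `≤` year, and differ only in the pending clause, vacuous at `P = none`. Every `CycleInv` lemma that speaks of the stage `s.W` (and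
`s.L`, `s.pt`) only thereby transfers to Ω⁺ stages. [folklore] -/
theorem CycleInvPlus.cycleInv_forget (h : CycleInvPlus k N ν s) (R : ∀ S : Scheme.{u}, CentreSeq S → Prop) :
    Moving.CycleInv k R N ν ⟨s.W, s.ln, s.L, none, s.pt⟩ where
  overField := h.overField
  isReduced := h.isReduced
  dim_le := h.dim_le
  supMax := h.supMax
  label_le_year := h.label_le_year
  pending := fun _ hQ => by cases hQ

/-- `Spec 𝒪_{X_n,η}` is excellent at an Ω⁺ stage under the invariant. [cite: Matsumura1987, §32 p. 260] -/
theorem CycleInvPlus.isExcellent_Spec_stalk (h : CycleInvPlus k N ν s) (η : s.W) :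
    Scheme.IsExcellent (Spec (s.W.presheaf.stalk η)) :=
  (h.cycleInv_forget fun _ _ => True).isExcellent_Spec_stalk η

/-- `Spec 𝒪_{X_n,η}` is reduced at an Ω⁺ stage under the invariant. [folklore] -/
theorem CycleInvPlus.isReduced_Spec_stalk (h : CycleInvPlus k N ν s) (η : s.W) : IsReduced (Spec (s.W.presheaf.stalk η)) := by
  haveI := h.isReduced
  infer_instance

/-- **AT A NEVER-ISOLATED MARKED POINT `{x_n}` IS NOT A COMPONENT OF `X_n(ν)`**, Ω⁺ stage (stub-4's lemma, transferred). [cite: CossartJannsenSaito2020, Lemma 2.36, Def. 2.35] -/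
theorem CycleInvPlus.singleton_notMem_componentsIn_of_not_iso (h : CycleInvPlus k N ν s)
    (hpt : s.pt ∈ Scheme.hsStratum s.W N ν) (hni : ¬ Iso N s) : {s.pt} ∉ componentsIn (Scheme.hsStratum s.W N ν) :=
  (h.cycleInv_forget fun _ _ => True).singleton_notMem_componentsIn_of_not_iso hpt fun hI => hni hI

/-- **THE CLOSED POINT OF `Spec 𝒪_{X_n,η}` IS ISOLATED IN ITS HILBERT–SAMUEL LOCUS** for `η` the generic point of a component of `X_n(ν)`,
Ω⁺ stage (res-type-053's lemma, transferred). [cite: CossartJannsenSaito2020, Lemma 6.30, Def. 13.3] -/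
theorem CycleInvPlus.isIsolatedInHSMaxLocus_closedPoint_of_isGenericPoint (h : CycleInvPlus k N ν s) {Z : Set s.W}
    (hZ : Z ∈ componentsIn (Scheme.hsStratum s.W N ν)) {η : s.W} (hη : IsGenericPoint η Z) :
    @IsIsolatedInHSMaxLocus (Spec (s.W.presheaf.stalk η)) (by haveI := s.ln; infer_instance) N
      (closedPoint (s.W.presheaf.stalk η)) :=
  (h.cycleInv_forget fun _ _ => True).isIsolatedInHSMaxLocus_closedPoint_of_isGenericPoint hZ hη

end Stage

/-! ## §3. The transfer row (T) along Ω⁺-chains -/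

section Omega

variable {ω : StageOracle.{u}} {N : ℕ} {ν : ℕ → ℕ}

/-- **THE TRANSFER ROW (T) ALONG Ω⁺-CHAINS — PROVED.** For a functional Ω⁺-admissible stage oracle `ω`, `ν ≠ Φ^{(N)}`, a maximal origin,
a chain of Ω⁺-steps (`CanonicalNearStepσ (Strategy.ofStageOraclePlus ω)`) from it which is never isolated, and a MOVING LINEAGE along it
(components `Z n ∋ x_n` of the strata, `Z (n+1)` dominating `Z n` under a step projection, `Z m` inside the centre of an allowed step for
infinitely many `m`): there is an infinite chain of LOCAL near-point steps `(S_i, s_i)` with `S_0` excellent, reduced, of dimension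
`≤ N − 1`, every `s_i` isolated in the Hilbert–Samuel locus of `S_i` (res-type-053's construction: generic points, hits enumerated by
`Nat.nth`, `S_i = Spec 𝒪_{X_{m_i}, η_{m_i}}`, stalk isomorphisms along the misses). [cite: CossartJannsenSaito2020, Lemma 6.30, Prop. 6.31, p. 107] -/
theorem movingLineageLocalizes_Ωplus (hωf : OracleFunctionalΩ ω) (hω : OracleAdmissibleΩplus ω) (hν : ν ≠ iterPSum N Phi)
    {p : ℕ} {X : Scheme.{u}} [IsLocallyNoetherian X] {x : X} (hX : IsMaximalOrigin p N ν X x) {c : ℕ → MarkedStage.{u}}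
    (h0 : Reachesσ (Strategy.ofStageOraclePlus ω) N ν (MarkedStage.init X x) (c 0))
    (hstep : ∀ n, CanonicalNearStepσ (Strategy.ofStageOraclePlus ω) N ν (c n) (c (n + 1))) (hnot : ∀ n, ¬ Iso N (c n))
    {Z : ∀ n, Set (c n).W} (hZcomp : ∀ n, Z n ∈ componentsThrough N ν (c n))
    (hZdom : ∀ n, ∃ g : (c (n + 1)).W ⟶ (c n).W, StepProjectionσ (Strategy.ofStageOraclePlus ω) N ν (c n) (c (n + 1)) g ∧
      closure (g.base '' Z (n + 1)) = Z n)
    (hZhit : ∀ n, ∃ m, n ≤ m ∧ ∃ (D : (c m).W.IdealSheafData) (P' : Option (Pending (blowup D))),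
      (Strategy.ofStageOraclePlus ω).step (c m).W (c m).ln N ν (c m).L (c m).P D P' ∧ Z m ⊆ (D.support : Set (c m).W)) :
    ∃ (S : ℕ → Scheme.{u}) (ln : ∀ i, IsLocallyNoetherian (S i)) (pt : ∀ i, S i),
      Scheme.IsExcellent (S 0) ∧ IsReduced (S 0) ∧ topologicalKrullDim ↥(S 0) ≤ ((N - 1 : ℕ) : WithBot ℕ∞) ∧
      IsLocalNearPointChain N S pt ∧ ∀ i, @IsIsolatedInHSMaxLocus (S i) (ln i) N (pt i) := by
  -- 1. the Ω⁺ cycle invariant along the chain; marked points; the lineage's components are closed irreducible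
  obtain ⟨k, _, hinv⟩ := exists_cycleInvPlus_chain hω hν hX h0 hstep
  have hpt : ∀ n, (c n).pt ∈ Scheme.hsStratum (c n).W N ν := fun n =>
    pt_mem_hsStratum_of_reachesσ (reachesσ_chain h0 hstep n) hX.mem_stratum
  have hptcl : ∀ n, IsClosed ({(c n).pt} : Set (c n).W) := fun n =>
    (reachesσ_chain h0 hstep n).isClosed_pt hX.isClosed
  have hZcl : ∀ n, IsClosed (Z n) := fun n => componentsIn.isClosed (hinv n).isClosed_hsStratum (hZcomp n).1
  have hZirr : ∀ n, IsIrreducible (Z n) := fun n => componentsIn.isIrreducible (hZcomp n).1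
  -- the lineage's step projections, the centres they present, and the blow-up data
  choose f hf hdom using hZdom
  have hfC : ∀ n, ∃ C : (c n).W.IdealSheafData,
      (∃ P' : Option (Pending (blowup C)), IsCanonicalStepΩplus ω (c n).ln N ν (c n).L (c n).P C P') ∧ IsBlowup (f n) C := by
    intro n
    obtain ⟨C, P', hln, x', hcs, -, -, -, e, hfe⟩ := hf n
    refine ⟨C, ⟨P', hcs⟩, ?_⟩
    rw [hfe]
    exact (blowup.isBlowup C).iso_comp (eqToIso (congrArg MarkedStage.W e))
  choose C hC hb using hfC
  have hcen : ∀ n, Literature.AlgebraicGeometry.Resolution.Scheme.IsRegular (C n).subscheme ∧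
      ((C n).support : Set (c n).W) ⊆ Scheme.hsStratum (c n).W N ν := fun n => by
    obtain ⟨P', hcs⟩ := hC n
    obtain ⟨h1, h2, -, -⟩ := (hinv n).centre hω hν hcs
    exact ⟨h1, h2⟩
  have hrad : ∀ n, C n = vanishingIdeal (C n).support := fun n =>
    Helpers.eq_vanishingIdeal_support_of_isRegular_subscheme _ (hcen n).1
  -- 2. generic points
  let η : ∀ n, (c n).W := fun n => (hZirr n).genericPoint
  have hη : ∀ n, IsGenericPoint (η n) (Z n) := fun n => by
    have h := (hZirr n).isGenericPoint_genericPoint_closure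
    rwa [(hZcl n).closure_eq] at h
  have hover : ∀ n, (f n).base (η (n + 1)) = η n := base_genericPoint_of_dom hη hdom
  have hην : ∀ n, η n ∈ Scheme.hsStratum (c n).W N ν := fun n => componentsIn.subset (hZcomp n).1 (hη n).mem
  have hptne : ∀ n, (c n).pt ≠ η n := fun n h => by
    have hZs : Z n = {(c n).pt} := by rw [← (hη n).def, ← h, (hptcl n).closure_eq]
    exact (hinv n).singleton_notMem_componentsIn_of_not_iso (hpt n) (hnot n) (hZs ▸ (hZcomp n).1)
  -- hits, read on the presented centres (functional stage oracle: the allowed centre is unique)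
  have hhit : ∀ n, ∃ m, n ≤ m ∧ η m ∈ ((C m).support : Set (c m).W) := fun n => by
    obtain ⟨m, hnm, D, P', hcs', hZD⟩ := hZhit n
    obtain ⟨P, hcs⟩ := hC m
    have hDC : D = C m := IsCanonicalStepΩplus.centre_unique hωf hcs' hcs
    subst hDC
    exact ⟨m, hnm, hZD (hη m).mem⟩
  -- the tail on which fibres are «closed»
  obtain ⟨n₀, huniq⟩ := exists_forall_eq_genericPoint_of_specializes_of_isBlowup hb (fun n => (hinv n).dim_le) hη hdom
  -- 3. the hits after `n₀`, enumerated
  let P : ℕ → Prop := fun m => n₀ ≤ m ∧ η m ∈ ((C m).support : Set (c m).W)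
  have hPinf : (setOf P).Infinite := by
    refine Set.infinite_of_forall_exists_gt fun n => ?_
    obtain ⟨m, hnm, hm⟩ := hhit (max n₀ n + 1)
    exact ⟨m, ⟨le_trans (le_max_left _ _) (Nat.le_of_succ_le hnm), hm⟩, lt_of_lt_of_le (Nat.lt_succ_of_le (le_max_right _ _)) hnm⟩
  let mH : ℕ → ℕ := Nat.nth P
  have hmH : ∀ i, P (mH i) := Nat.nth_mem_of_infinite hPinf
  have hmHmono : StrictMono mH := Nat.nth_strictMono hPinf
  have hmiss : ∀ i j, j < mH (i + 1) - (mH i + 1) →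
      η (mH i + 1 + j) ∉ ((C (mH i + 1 + j)).support : Set (c (mH i + 1 + j)).W) := by
    intro i j hj hmem
    have hlt : mH i + 1 + j < mH (i + 1) := by omega
    have hPm : P (mH i + 1 + j) := ⟨le_trans (hmH i).1 (by omega), hmem⟩
    have := Nat.le_nth_of_lt_nth_succ hlt hPm
    change mH i + 1 + j ≤ mH i at this
    omega
  -- 4. the local schemes
  let S : ℕ → Scheme.{u} := fun i => Spec ((c (mH i)).W.presheaf.stalk (η (mH i)))
  have ln : ∀ i, IsLocallyNoetherian (S i) := fun i => by
    haveI := (c (mH i)).ln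
    show IsLocallyNoetherian (Spec _)
    infer_instance
  let pt : ∀ i, S i := fun i => closedPoint ((c (mH i)).W.presheaf.stalk (η (mH i)))
  refine ⟨S, ln, pt, (hinv (mH 0)).isExcellent_Spec_stalk _, (hinv (mH 0)).isReduced_Spec_stalk _, ?_, ?_, ?_⟩
  · -- dimension `≤ N - 1`
    have hN : N ≤ N - 1 + 1 := by omega
    have hdim' : topologicalKrullDim (c (mH 0)).W ≤ ((N - 1 + 1 : ℕ) : WithBot ℕ∞) :=
      (hinv (mH 0)).dim_le.trans (by exact_mod_cast hN)
    exact topologicalKrullDim_Spec_stalk_le_of_isGenericPoint (hη (mH 0)) (hZcomp (mH 0)).2 (hptne (mH 0)) (d := N - 1) hdim'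
  · -- the chain of local near-point steps
    intro i
    have hgap : mH i + 1 + (mH (i + 1) - (mH i + 1)) = mH (i + 1) := by
      have hlt : mH i < mH (i + 1) := hmHmono (Nat.lt_succ_self i)
      omega
    obtain ⟨e⟩ := nonempty_stalkIso_of_misses_of_isBlowup hb hover (mH i + 1) (mH (i + 1) - (mH i + 1)) (hmiss i)
    have hS' : IsLocalSchemeAt (S (i + 1)) (pt (i + 1)) (c (mH i + 1)).W (η (mH i + 1)) := by
      have e' : (c (mH i + 1)).W.presheaf.stalk (η (mH i + 1)) ≅ (c (mH (i + 1))).W.presheaf.stalk (η (mH (i + 1))) :=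
        e ≪≫ eqToIso (by rw [hgap])
      exact isLocalSchemeAt_Spec_of_iso e'
    haveI : IsLocallyNoetherian (c (mH i)).W := (c (mH i)).ln
    haveI : IsLocallyNoetherian (c (mH i + 1)).W := (c (mH i + 1)).ln
    have hZC : Z (mH i) ⊆ ((C (mH i)).support : Set (c (mH i)).W) :=
      ((hη (mH i)).mem_closed_set_iff (C (mH i)).support.isClosed).mp (hmH i).2
    have hnear : Scheme.hsFun (c (mH i + 1)).W N (η (mH i + 1)) = Scheme.hsFun (c (mH i)).W N (η (mH i)) := by
      rw [Scheme.mem_hsStratum_iff.mp (hην (mH i + 1)), Scheme.mem_hsStratum_iff.mp (hην (mH i))]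
    exact isLocalNearPointStep_of_isBlowup (hb (mH i)) (hrad (mH i))
      (stalkIdeal_eq_maximalIdeal_of_isGenericPoint_of_isRegular _ (hcen (mH i)).1
        (mem_componentsIn_of_subset (hZcomp (mH i)).1 (hcen (mH i)).2 hZC) (hη (mH i)))
      N (hover (mH i)) hnear (huniq (mH i) (hmH i).1) hS'
  · -- isolation
    intro i
    exact (hinv (mH i)).isIsolatedInHSMaxLocus_closedPoint_of_isGenericPoint (hZcomp (mH i)).1 (hη (mH i))

/-! ## §4. Row (c-geo)σ over Ω⁺ at `QNe Q`, and the feeds into brick 3b -/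

/-- **ROW (c-geo)σ `StrataLineageInCentreIOσ (Strategy.ofStageOraclePlus ω) p N (QNe Q) G` FROM THE KILL ROW, for `0 < N ≤ 3` — PROVED**
(functional Ω⁺-admissible stage oracle; every `p`, `Q`, `G`): a moving lineage localises (§3) to a local near-point chain on `S_0`
excellent, reduced, of dimension `≤ N − 1 ≤ 2` and `< N`, with isolated closed points, which the kill row forbids.
[cite: CossartJannsenSaito2020, Lemma 6.30, p. 98 Step 9, Cor. 6.37, Thm. 6.40, p. 107] -/
theorem strataLineageInCentreIOσ_of_localChains_Ωplus (hωf : OracleFunctionalΩ ω) (hω : OracleAdmissibleΩplus ω)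
    (hK : LocalNearPointChainsTerminate.{u}) (p : ℕ) (hN0 : 0 < N) (hN3 : N ≤ 3)
    (Q : ℕ → (ℕ → ℕ) → ∀ X : Scheme.{u}, X → Prop) (G : MarkedStage.{u} → Prop) :
    StrataLineageInCentreIOσ (Strategy.ofStageOraclePlus ω) p N (QNe Q) G := by
  intro ν X _ x hX hQ c h0 hstep _ hnot _
  rintro ⟨Z, hZcomp, hZdom, hZhit⟩
  obtain ⟨S, ln, pt, hexc, hred, hdim, hchain, hiso⟩ :=
    movingLineageLocalizes_Ωplus hωf hω hQ.2 hX h0 hstep hnot hZcomp hZdom hZhit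
  have h1 : ((N - 1 : ℕ) : WithBot ℕ∞) ≤ (2 : WithBot ℕ∞) := by
    have : N - 1 ≤ 2 := by omega
    exact_mod_cast this
  have h2 : ((N - 1 : ℕ) : WithBot ℕ∞) < (N : WithBot ℕ∞) := by
    have : N - 1 < N := by omega
    exact_mod_cast this
  exact hK N S ln pt hexc hred (hdim.trans h1) (lt_of_le_of_lt hdim h2) hchain hiso

/-- **ROW (c-geo)σ over Ω⁺ at level `3` and `QNe Q` FROM THE KILL ROW** — by name. [cite: CossartJannsenSaito2020, Lemma 6.30, p. 107] -/
theorem strataLineageInCentreIOσ_three_of_localChains_Ωplus (hωf : OracleFunctionalΩ ω) (hω : OracleAdmissibleΩplus ω)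
    (hK : LocalNearPointChainsTerminate.{u}) (p : ℕ) (Q : ℕ → (ℕ → ℕ) → ∀ X : Scheme.{u}, X → Prop)
    (G : MarkedStage.{u} → Prop) : StrataLineageInCentreIOσ (Strategy.ofStageOraclePlus ω) p 3 (QNe Q) G :=
  strataLineageInCentreIOσ_of_localChains_Ωplus hωf hω hK p (by norm_num) le_rfl Q G

/-- **ROW (c-geo)σ over Ω⁺ at `QNe Q`, `0 < N ≤ 3`, CLOSED MODULO PRINT**: the kill row is res-D-pv-046's
`localNearPointChainsTerminate_of_printedFacts` over the bundle `LocalChainPrintedFacts` of six printed named facts.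
[cite: CossartJannsenSaito2020, Lemma 6.30, p. 98 Step 9, Cor. 6.37, Thm. 6.40, Thm. 3.14, p. 107] -/
theorem strataLineageInCentreIOσ_of_printedFacts_Ωplus (hωf : OracleFunctionalΩ ω) (hω : OracleAdmissibleΩplus ω)
    (hF : LocalChainPrintedFacts.{u}) (p : ℕ) (hN0 : 0 < N) (hN3 : N ≤ 3)
    (Q : ℕ → (ℕ → ℕ) → ∀ X : Scheme.{u}, X → Prop) (G : MarkedStage.{u} → Prop) :
    StrataLineageInCentreIOσ (Strategy.ofStageOraclePlus ω) p N (QNe Q) G :=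
  strataLineageInCentreIOσ_of_localChains_Ωplus hωf hω (localNearPointChainsTerminate_of_printedFacts hF) p hN0 hN3 Q G

/-- **ROW (c)σ `StrataLineagesFiniteσ` over Ω⁺ at `QNe Q`, `0 < N ≤ 3`, FROM (c-rep)σ AND THE KILL ROW** (brick 3b's
`strataLineagesFiniteσ_of_centreIO_of_replaySettle_Ωplus` with its (c-geo) hypothesis discharged). [cite: CossartJannsenSaito2020, Rem. 6.29 (1), p. 105, Lemma 6.30] -/
theorem strataLineagesFiniteσ_of_replaySettle_localChains_Ωplus {p : ℕ} {Q : ℕ → (ℕ → ℕ) → ∀ X : Scheme.{u}, X → Prop}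
    {G : MarkedStage.{u} → Prop} (hωf : OracleFunctionalΩ ω) (hω : OracleAdmissibleΩplus ω)
    (hK : LocalNearPointChainsTerminate.{u}) (hN0 : 0 < N) (hN3 : N ≤ 3)
    (hrep : StrataReplayBlowupsSettleσ (Strategy.ofStageOraclePlus ω) p N (QNe Q) G) :
    StrataLineagesFiniteσ (Strategy.ofStageOraclePlus ω) p N (QNe Q) G :=
  strataLineagesFiniteσ_of_centreIO_of_replaySettle_Ωplus hωf hω
    (strataLineageInCentreIOσ_of_localChains_Ωplus hωf hω hK p hN0 hN3 Q G) hrep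

/-- **THE STRATA-HALF OVER Ω⁺ AT `QNe Q`, `0 < N ≤ 3`, FROM (b-end)σ, (c-rep)σ AND THE KILL ROW — PROVED** (brick 3b's
`maxOriginNoMovingNearChainAtQσ_notIso_of_kernels_Ωplus` with its dimension-two kernel (c-geo)σ discharged by §3): no moving, never-isolated
`G`-chain of Ω⁺-steps from a `QNe Q`-maximal origin. [cite: CossartJannsenSaito2020, Rem. 6.29 (1), Thm. 6.35, Prop. 6.31, Lemma 6.30] -/
theorem maxOriginNoMovingNearChainAtQσ_notIso_of_cycleEnd_replaySettle_localChains_Ωplus {p : ℕ}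
    {Q : ℕ → (ℕ → ℕ) → ∀ X : Scheme.{u}, X → Prop} {G : MarkedStage.{u} → Prop} (hωf : OracleFunctionalΩ ω)
    (hω : OracleAdmissibleΩplus ω) (hK : LocalNearPointChainsTerminate.{u}) (hN0 : 0 < N) (hN3 : N ≤ 3)
    (hend : StrataCycleEndBirthsSettleσ (Strategy.ofStageOraclePlus ω) p N (QNe Q) G)
    (hrep : StrataReplayBlowupsSettleσ (Strategy.ofStageOraclePlus ω) p N (QNe Q) G) :
    MaxOriginNoMovingNearChainAtQσ (Strategy.ofStageOraclePlus ω) p N (QNe Q) fun s => G s ∧ ¬ Iso N s :=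
  maxOriginNoMovingNearChainAtQσ_notIso_of_kernels_Ωplus hωf hω hend
    (strataLineageInCentreIOσ_of_localChains_Ωplus hωf hω hK p hN0 hN3 Q G) hrep

/-- **… at level `3`, CLOSED MODULO PRINT and the two OPEN σ-rows (b-end)σ⁺, (c-rep)σ⁺** — the Ω⁺ twin of stub-4's strata-half census
line «(c-geo) = card H (PROVED modulo `LocalChainPrintedFacts`)». [cite: CossartJannsenSaito2020, Rem. 6.29 (1), Thm. 6.35, Lemma 6.30, p. 107] -/
theorem maxOriginNoMovingNearChainAtQσ_notIso_three_of_cycleEnd_replaySettle_printedFacts_Ωplus {p : ℕ}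
    {Q : ℕ → (ℕ → ℕ) → ∀ X : Scheme.{u}, X → Prop} {G : MarkedStage.{u} → Prop} (hωf : OracleFunctionalΩ ω)
    (hω : OracleAdmissibleΩplus ω) (hF : LocalChainPrintedFacts.{u})
    (hend : StrataCycleEndBirthsSettleσ (Strategy.ofStageOraclePlus ω) p 3 (QNe Q) G)
    (hrep : StrataReplayBlowupsSettleσ (Strategy.ofStageOraclePlus ω) p 3 (QNe Q) G) :
    MaxOriginNoMovingNearChainAtQσ (Strategy.ofStageOraclePlus ω) p 3 (QNe Q) fun s => G s ∧ ¬ Iso 3 s :=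
  maxOriginNoMovingNearChainAtQσ_notIso_of_cycleEnd_replaySettle_localChains_Ωplus hωf hω
    (localNearPointChainsTerminate_of_printedFacts hF) (by norm_num) le_rfl hend hrep

end Omega

end Summit.ResolutionOfSingularities.ResolutionOfSingularities.Theorems.SigmaMaxModificationsCorridor3.Sigma

end
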